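import Literature.NumberTheory.Sieve.LinearEquationsInPrimesGowersU2
import Literature.NumberTheory.Sieve.LinearEquationsInPrimesNormalFormProofs
import HarnessLib

/-!
# The Main Theorem of Green–Tao 2010 level by level; systems of at most three forms (unconditional)

Topic `Literature/NumberTheory/Sieve`. Two proved theorems, no definitions, no named facts.

* `GreenTao2010_main_of_mainNormalFormAt` — **§4 of Green–Tao, *Linear equations in primes*,
  Ann. of Math. 171 (2010), level by level**: the normal-form statement Thm. 4.5 at a single level
  `s` already gives the generalised Hardy–Littlewood asymptotic (Main Theorem = Thm. 1.2 restricted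
  to finite complexity, `Literature.NumberTheory.Sieve.GreenTaoZiegler2012_finiteComplexity`) for all
  systems of finite complexity consisting of `t ≤ s + 2` forms. This is the printed argument
  (elimination of the archimedean factor, the normal form extension of Lemma 4.4, which produces a
  `(t − 2)`-normal form — Lemma 1.6: "the complexity is at most `t − 2`" —, Thm. 4.5 at scale
  `N' = (1 + 2t²L)N`, change of variables and division by `(2N+1)^{t²}`), i.e. verbatim the proof
  of the tree's `GreenTao2010_main_of_mainNormalForm_holds` (`LinearEquationsInPrimesMainReduction.lean`)
  with the level `max(1, t − 2)` replaced by any `s ≥ t − 2`.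
* `GreenTao2010_mainTheorem_of_le_three` — consequently, by the unconditional level-`1` Gowers
  uniformity estimate `GreenTao2010_gowersUniformityAt_one` (`LinearEquationsInPrimesGowersU2.lean`)
  and the proved reductions §7 (`GreenTao2010_wTrickedProduct_of_gowersUniformity_holds`),
  Thm. 5.2 ⇒ 5.1 (`GreenTao2010_wTricked_of_wTrickedProduct`) and §5
  (`GreenTao2010_mainNormalForm_of_wTricked_holds`) giving Thm. 4.5 at `s = 1` (recorded as
  `GreenTao2010_mainNormalFormAt_one` in `LinearEquationsInPrimesLevelOne.lean`), **the Main Theorem of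
  Green–Tao 2010 holds unconditionally (in this tree) for every system of at most three
  affine-linear forms of finite complexity** (no two linear parts parallel) — e.g. three-term
  arithmetic progressions `(n₁, n₁ + n₂, n₁ + 2n₂)`, or `(n₁, n₂, n₁ + n₂)` (cf. GT2010, Cor. 1.7 and
  Examples 1–2): `∑_{n ∈ K ∩ ℤ^d} ∏ᵢ Λ(ψᵢ(n)) = β_∞ ∏_p β_p + o(N^d)`.

## References

* [GreenTao2010] B. Green, T. Tao, *Linear equations in primes*, Ann. of Math. 171 (2010),
  1753–1850: Main Theorem (Thm. 1.2 for finite complexity), Lemma 1.6, §4 (Thm. 4.1, Lemma 4.4,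
  Thm. 4.5, "Proof of the Main Theorem assuming Theorem 4.5") (arXiv:math/0606088).
-/

noncomputable section

open Filter Finset MeasureTheory
open scoped Topology

namespace Literature.NumberTheory.Sieve

/-- **§4 of Green–Tao 2010, level by level**: Thm. 4.5 at level `s` implies the Main Theorem for
all systems of finite complexity with `t ≤ s + 2` forms (the normal form extension of Lemma 4.4 of
a finite-complexity system of `t` forms is in `(t − 2)`-normal form, Lemma 1.6). Proof verbatim
that of `GreenTao2010_main_of_mainNormalForm_holds`.
[cite: GreenTao2010, §4 (Proof of the Main Theorem assuming Theorem 4.5) and Lemma 1.6] -/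
theorem GreenTao2010_main_of_mainNormalFormAt {s : ℕ} (hNF : GreenTao2010_mainNormalFormAt s) :
    ∀ (d t L : ℕ), 1 ≤ d → 1 ≤ t → t ≤ s + 2 → ∀ ε : ℝ, 0 < ε → ∃ N₀ : ℕ, ∀ N : ℕ, N₀ ≤ N →
      ∀ Ψ : Fin t → AffLinForm d, IsNondegenerateSystem Ψ → IsFiniteComplexitySystem Ψ →
        affLinSize Ψ N ≤ L →
        ∀ K : Set (Fin d → ℝ), Convex ℝ K → K ⊆ realBox d N →
          |vonMangoldtSum Ψ K N - archFactor Ψ K * singularProduct Ψ| ≤ ε * (N : ℝ) ^ d := by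
  intro d t L hd ht hts ε hε
  classical
  -- constants depending only on `d, t, L` (and `ε`)
  obtain ⟨C, hC⟩ : ∃ C : ℕ, C = 1 + t * t * (2 * L) := ⟨_, rfl⟩
  obtain ⟨L', hL'⟩ : ∃ L' : ℕ, L' = t * (d + t * t) * (L + d * L * (2 * L)) + L := ⟨_, rfl⟩
  obtain ⟨B, hB0, hB⟩ := singularProduct_mem_Icc_uniform t L
  obtain ⟨Cd, hCd⟩ := GreenTao2010_latticePointsConvexBody_holds d hd
  have hC1 : 1 ≤ C := by rw [hC]; exact Nat.le_add_right 1 _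
  have hCr1 : (1 : ℝ) ≤ C := by exact_mod_cast hC1
  have hCr0 : (0 : ℝ) < C := by linarith
  have hε' : 0 < ε / (4 * (C : ℝ) ^ (d + t * t)) := by positivity
  obtain ⟨N₁, hN₁⟩ := hNF (d + t * t) t L' (le_trans hd (Nat.le_add_right d _)) ht _ hε'
  obtain ⟨A, hA⟩ : ∃ A : ℝ, A = (C : ℝ) + t * (1 + B) + |Cd| * B + 1 := ⟨_, rfl⟩
  have htB0 : 0 ≤ (t : ℝ) * (1 + B) := by positivity
  have hCdB0 : 0 ≤ |Cd| * B := by positivity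
  have hA1 : 1 ≤ A := by rw [hA]; linarith
  have hA0 : 0 ≤ A := by linarith
  have hCA : (C : ℝ) ≤ A := by rw [hA]; linarith
  have htA : (t : ℝ) * (1 + B) ≤ A := by rw [hA]; linarith
  have hCdA : |Cd| * B ≤ A := by rw [hA]; linarith
  have hL₁ : (1 : ℝ) ≤ max (L : ℝ) 1 := le_max_right _ _
  obtain ⟨N₂, hN₂⟩ := slab_error_eventually hA1 hL₁ (by positivity : 0 < ε / 4) d t hd
  refine ⟨max N₁ (max N₂ 1), fun N hN Ψ hΨ hfc hL K hK hKN => ?_⟩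
  have hN₁N : N₁ ≤ N := le_trans (le_max_left _ _) hN
  have hN₂N : N₂ ≤ N := le_trans ((le_max_left _ _).trans (le_max_right _ _)) hN
  have hN1 : 1 ≤ N := le_trans ((le_max_right _ _).trans (le_max_right _ _)) hN
  have hNr1 : (1 : ℝ) ≤ N := by exact_mod_cast hN1
  have hNr0 : (0 : ℝ) < N := by linarith
  -- coefficient bound and the normal form extension (Lemma 4.4)
  have hcoef : ∀ i j, ((Ψ i).coeff j).natAbs ≤ L := fun i j =>
    natAbs_coeff_le_of_affLinSize_le hL i j
  obtain ⟨f, hfM, hnf⟩ := GreenTao2010_existsNormalFormExtension Ψ hΨ hfc hcoef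
  -- the singular product is bounded
  obtain ⟨hS0, hSB⟩ := hB d Ψ hΨ hfc hcoef
  -- the scale `N' = C N` and the threshold `H = ⌈N'^{8/10}⌉`
  obtain ⟨N', hN'⟩ : ∃ N' : ℕ, N' = C * N := ⟨_, rfl⟩
  have hNN' : N ≤ N' := by rw [hN']; exact Nat.le_mul_of_pos_left N (by omega)
  have hN'r : ((N' : ℕ) : ℝ) = (C : ℝ) * N := by rw [hN']; push_cast; ring
  obtain ⟨H, hH⟩ : ∃ H : ℕ, H = ⌈((N' : ℕ) : ℝ) ^ ((8 : ℝ) / 10)⌉₊ := ⟨_, rfl⟩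
  have hKH : posBody Ψ (H : ℝ) K ⊆ realBox d N := (posBody_subset Ψ _ K).trans hKN
  -- Step 1: Thm. 4.5 for the extension `Ψ'` on the body `K'` at scale `N'`
  have h45 : |vonMangoldtSum (fun i => (Ψ i).extendAlong f) (extBody f (N : ℝ) (posBody Ψ (H : ℝ) K)) N' -
      latticePointCount (extBody f (N : ℝ) (posBody Ψ (H : ℝ) K)) N' *
        singularProduct (fun i => (Ψ i).extendAlong f)| ≤
      ε / (4 * (C : ℝ) ^ (d + t * t)) * ((N' : ℕ) : ℝ) ^ (d + t * t) := by
    refine hN₁ N' (hN₁N.trans hNN') _ (isNondegenerateSystem_extendAlong hΨ f)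
      (hnf.mono (by omega)) ?_ _ (convex_extBody f N (convex_posBody Ψ (H : ℝ) hK)) ?_ ?_
    · rw [hL']
      exact affLinSize_extendAlong_le hNr0 (by exact_mod_cast hNN') hL hfM
    · refine extBody_subset_realBox f hfM hNr0.le (le_of_eq ?_) hKH
      rw [hN'r, hC]
      push_cast
      ring
    · intro x hx i
      have hHc : ((N' : ℕ) : ℝ) ^ ((8 : ℝ) / 10) ≤ (H : ℝ) := by rw [hH]; exact Nat.le_ceil _
      exact lt_of_le_of_lt hHc (extendAlong_realEval_gt_of_mem_extBody f
        (fun y hy j => realEval_gt_of_mem_posBody hy j) hx i)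
  -- Step 2: the change of variables `r := n + ∑ mₗ fₗ` and division by `(2N+1)^k`
  have hle : (1 + t * t * (2 * L)) * N ≤ N' := by rw [hN', hC]
  rw [vonMangoldtSum_extendAlong_extBody Ψ f hfM hle hKH, latticePointCount_extBody f hfM hle hKH,
    singularProduct_extendAlong] at h45
  have hQ : (0 : ℝ) < (2 * (N : ℝ) + 1) ^ (t * t) := by positivity
  have h2 : |vonMangoldtSum Ψ (posBody Ψ (H : ℝ) K) N -
      latticePointCount (posBody Ψ (H : ℝ) K) N * singularProduct Ψ| ≤ ε / 4 * (N : ℝ) ^ d := by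
    refine le_of_mul_le_mul_left ?_ hQ
    have hlhs : (2 * (N : ℝ) + 1) ^ (t * t) *
        |vonMangoldtSum Ψ (posBody Ψ (H : ℝ) K) N -
          latticePointCount (posBody Ψ (H : ℝ) K) N * singularProduct Ψ| =
        |(2 * (N : ℝ) + 1) ^ (t * t) * vonMangoldtSum Ψ (posBody Ψ (H : ℝ) K) N -
          (((2 * N + 1) ^ (t * t) * latticePointCount (posBody Ψ (H : ℝ) K) N : ℕ) : ℝ) *
            singularProduct Ψ| := by
      rw [← abs_of_pos hQ, ← abs_mul, abs_of_pos hQ]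
      congr 1
      push_cast
      ring
    rw [hlhs]
    refine h45.trans ?_
    rw [hN'r, mul_pow, pow_add (N : ℝ)]
    have hCpow : (C : ℝ) ^ (d + t * t) ≠ 0 := by positivity
    calc ε / (4 * (C : ℝ) ^ (d + t * t)) * ((C : ℝ) ^ (d + t * t) * ((N : ℝ) ^ d * (N : ℝ) ^ (t * t)))
        = ε / 4 * (N : ℝ) ^ d * (N : ℝ) ^ (t * t) := by
          field_simp
      _ ≤ ε / 4 * (N : ℝ) ^ d * (2 * (N : ℝ) + 1) ^ (t * t) :=
          mul_le_mul_of_nonneg_left (pow_le_pow_left₀ hNr0.le (by linarith) _) (by positivity)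
      _ = (2 * (N : ℝ) + 1) ^ (t * t) * (ε / 4 * (N : ℝ) ^ d) := by ring
  -- Step 3: the crude bounds (slab `0 < ψᵢ ≤ H`, lattice points vs volume)
  have e1 := vonMangoldtSum_sub_posBody_le hΨ hN1 hL₁ (hL.trans (le_max_left _ _)) K H
  have e3 : (latticePointCount (posBody Ψ 0 K) N : ℝ) ≤
      latticePointCount (posBody Ψ (H : ℝ) K) N + t * ((H : ℝ) * (2 * N + 1) ^ (d - 1)) := by
    exact_mod_cast latticePointCount_posBody_le hΨ K N H
  have e3' : (latticePointCount (posBody Ψ (H : ℝ) K) N : ℝ) ≤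
      latticePointCount (posBody Ψ 0 K) N := by
    exact_mod_cast latticePointCount_mono (posBody_mono Ψ (Nat.cast_nonneg H) K) N
  have e4 : |(latticePointCount (posBody Ψ 0 K) N : ℝ) - archFactor Ψ K| ≤ Cd * (N : ℝ) ^ (d - 1) :=
    hCd N hN1 (posBody Ψ 0 K) (convex_posBody Ψ 0 hK) ((posBody_subset Ψ 0 K).trans hKN)
  have hslab := hN₂ N hN₂N
  have hHG : (H : ℝ) ≤ (A * N) ^ ((8 : ℝ) / 10) + 1 := by
    have h1 : (H : ℝ) < ((N' : ℕ) : ℝ) ^ ((8 : ℝ) / 10) + 1 := by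
      rw [hH]
      exact Nat.ceil_lt_add_one (by positivity)
    have h2 : ((N' : ℕ) : ℝ) ^ ((8 : ℝ) / 10) ≤ (A * N) ^ ((8 : ℝ) / 10) := by
      refine Real.rpow_le_rpow (by positivity) ?_ (by norm_num)
      rw [hN'r]
      exact mul_le_mul_of_nonneg_right hCA hNr0.le
    linarith
  -- Step 4: bookkeeping
  have h2LN : (1 : ℝ) ≤ 2 * max (L : ℝ) 1 * N := by
    have := one_le_mul_of_one_le_of_one_le hL₁ hNr1
    linarith
  have hlog0 : 0 ≤ Real.log (2 * max (L : ℝ) 1 * N) := Real.log_nonneg h2LN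
  have hΛLg : Real.log (2 * max (L : ℝ) 1 * N) ^ t ≤ (1 + Real.log (2 * max (L : ℝ) 1 * N)) ^ t :=
    pow_le_pow_left₀ hlog0 (by linarith) t
  have hLg1 : 1 ≤ (1 + Real.log (2 * max (L : ℝ) 1 * N)) ^ t := one_le_pow₀ (by linarith)
  have hG1 : 1 ≤ (A * N) ^ ((8 : ℝ) / 10) + 1 := by
    have : 0 ≤ (A * N) ^ ((8 : ℝ) / 10) := Real.rpow_nonneg (by positivity) _
    linarith
  have hNP : (N : ℝ) ^ (d - 1) ≤ (2 * (N : ℝ) + 1) ^ (d - 1) :=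
    pow_le_pow_left₀ hNr0.le (by linarith) _
  have hεN : 0 ≤ ε * (N : ℝ) ^ d := by positivity
  have key := archimedean_bookkeeping hS0 hSB hB0 e1.1 e1.2 h2 e3 e3' e4 hNP (by positivity) hHG
    (Nat.cast_nonneg H) (by positivity) hA0 (Nat.cast_nonneg t) htA hCdA hΛLg hLg1 hG1 hslab
  linarith


/-- **The Main Theorem of Green–Tao 2010 for systems of at most three forms, unconditionally**:
for every `d ≥ 1`, `1 ≤ t ≤ 3`, `L` and `ε > 0` there is `N₀` such that for `N ≥ N₀`, every
nondegenerate system `Ψ` of `t` affine-linear forms in `d` variables of finite complexity with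
`‖Ψ‖_N ≤ L` and every convex `K ⊆ [−N, N]^d`,
`|∑_{n ∈ K ∩ ℤ^d} ∏ᵢ Λ(ψᵢ(n)) − β_∞ ∏_p β_p| ≤ ε N^d`. From Thm. 4.5 at `s = 1` (Thm. 7.2 at
`s = 1`, `GreenTao2010_gowersUniformityAt_one`, through the proved §7, Thm. 5.2 ⇒ 5.1 and §5) and
the level-by-level §4. [cite: GreenTao2010, Main Theorem (case of complexity `≤ 1`), Cor. 1.7] -/
theorem GreenTao2010_mainTheorem_of_le_three :
    ∀ (d t L : ℕ), 1 ≤ d → 1 ≤ t → t ≤ 3 → ∀ ε : ℝ, 0 < ε → ∃ N₀ : ℕ, ∀ N : ℕ, N₀ ≤ N →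
      ∀ Ψ : Fin t → AffLinForm d, IsNondegenerateSystem Ψ → IsFiniteComplexitySystem Ψ →
        affLinSize Ψ N ≤ L →
        ∀ K : Set (Fin d → ℝ), Convex ℝ K → K ⊆ realBox d N →
          |vonMangoldtSum Ψ K N - archFactor Ψ K * singularProduct Ψ| ≤ ε * (N : ℝ) ^ d :=
  GreenTao2010_main_of_mainNormalFormAt (s := 1)
    (GreenTao2010_mainNormalForm_of_wTricked_holds 1 le_rfl
      (GreenTao2010_wTricked_of_wTrickedProduct 1
        (GreenTao2010_wTrickedProduct_of_gowersUniformity_holds 1 le_rfl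
          GreenTao2010_gowersUniformityAt_one)))

end Literature.NumberTheory.Sieve
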